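import Literature.Analysis.FluidPDE.PeriodicCylinderNeumannWallWords
import Literature.Analysis.FluidPDE.PeriodicCylinderNeumannFrameWordsAll
import HarnessLib

/-!
# The Neumann problem on the period cell near the wall: constant words on `{r ≥ 1/2}`, all orders

Topic `Literature/Analysis/FluidPDE`. Support file (all results proved, no definitions, no named
facts): the general-order version of `PeriodicCylinderNeumannWallWords.exists_annulusL2_constWord_le`
(there: words of length `≤ 4`, the order of Ferrari's `H³` pressure estimate). Near the wall
(`1/2 ≤ r ≤ 1`) every constant-direction word `∂_{v₁}⋯∂_{v_n} q` is, pointwise, a bounded combination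
of the frame words `X_ω q`, `ω ∈ {x_h·∇, ∂_θ, ∂_z}^{≤ n}` (`exists_norm_cylWord_constFields_le_frameSum`,
every `n`); every frame word is a sorted word `P^a J^j E^e q` (`frameWord_normalForm`), and these are
controlled, for a smooth periodic Neumann solution `x_h·∇q = G` on the wall and for every length, by
`‖∇q‖ + frameSize N (Δ_K q) + tanSize N G + frameSize N G` (`exists_cellL2_pje_le_neumann`,
`PeriodicCylinderNeumannFrameWordsAll`). The zeroth-order frame term is removed by working with
`q − ⨍q` (Poincaré on the cell). Main result `exists_annulusL2_constWord_le_all`: for `L > 0`, `M ≥ 1`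
and every `N` there is `C` with
`‖∂_{v₁}⋯∂_{v_n} q‖_{L²(cell ∩ {r ≥ 1/2})} ≤ C (‖∇q‖ + frameSize N (Δ_K q) + tanSize N G + frameSize N G + ‖∇q‖)`
for all such `q, G`, all `1 ≤ n ≤ N + 2` and letters of norm `≤ M` (the proof of the order-`4` theorem
verbatim). Part of the general-order `H^k` estimate for the Neumann problem / Helmholtz projector on
the periodic cylinder (T. Kato, C. Y. Lai, J. Funct. Anal. 56 (1984) §4 (i); the analytic input of
`Literature.Analysis.FluidPDE.KatoLai1984_periodicCylinderUniformExistence`). Folklore calculus.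

Mathlib/tree search: everything from `PeriodicCylinderNeumannWallWords`, `PeriodicCylinderFrameInversion`,
`PeriodicCylinderNeumannFrameWordsAll`; no general-order statement existed.

## References

* T. Kato, C. Y. Lai, J. Funct. Anal. 56 (1984) 15–28, §4 (i). [KatoLai1984]
* A. B. Ferrari, Comm. Math. Phys. 155 (1993), Lemma 2 pp. 280–281. [Ferrari1993]
-/

noncomputable section

open MeasureTheory Set Function Filter Topology TopologicalSpace WithLp Metric
open scoped ContDiff NNReal ENNReal InnerProductSpace RealInnerProductSpace

namespace Literature.Analysis.FluidPDE

open Literature.Analysis.FunctionSpaces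

/-- Local notation for physical space `ℝ³ = EuclideanSpace ℝ (Fin 3)`. -/
local notation "ℝ³" => EuclideanSpace ℝ (Fin 3)

/-- Local notation for the closed unit cylinder `{r ≤ 1}`. -/
local notation "𝕂" => closure (SetLike.coe unitCylinder : Set (EuclideanSpace ℝ (Fin 3)))

/-- Local notation for the radial field `P = x_h`. -/
local notation "Pf" => (fun y : EuclideanSpace ℝ (Fin 3) => horizontalProj y)

/-- **Constant words of `q` on the annulus `{r ≥ 1/2}` by the data of the Neumann problem, all
orders.** For `L > 0`, `M ≥ 1` and every `N` there is `C` such that for all `q`, `G` smooth on the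
closed cylinder, `L`-periodic, with `x_h·∇q = G` on the wall, and every word of `1 ≤ n ≤ N + 2`
constant letters of norm `≤ M`,
`‖∂_{v₁}⋯∂_{v_n} q‖_{L²(cell ∩ {r ≥ 1/2})} ≤ C ((‖∇q‖ + frameSize N (Δ_K q) + tanSize N G + frameSize N G) + ‖∇q‖)`.
[folklore] -/
theorem exists_annulusL2_constWord_le_all {L : ℝ} (hL : 0 < L) {M : ℝ} (hM1 : 1 ≤ M) (N : ℕ) :
    ∃ C : ℝ, 0 ≤ C ∧ ∀ (q G : ℝ³ → ℝ), ContDiffOn ℝ ∞ q 𝕂 → ContDiffOn ℝ ∞ G 𝕂 →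
      IsAxiallyPeriodic L q → IsAxiallyPeriodic L G →
      (∀ x ∈ frontier (unitCylinder : Set ℝ³), cylDeriv Pf q x = G x) →
      ∀ vs : List ℝ³, 1 ≤ vs.length → vs.length ≤ N + 2 → (∀ v ∈ vs, ‖v‖ ≤ M) →
        (eLpNorm (cylWord (constFields vs) q) 2
          (volume.restrict ((cylinderCell L : Set ℝ³) ∩ {x | (1 : ℝ) / 2 ≤ cylRadius x}))).toReal ≤
          C * ((cellL2 L (cylGrad q) + frameSize L N (cylLap q) + tanSize L N G + frameSize L N G) +
            cellL2 L (cylGrad q)) := by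
  have hM0 : 0 ≤ M := zero_le_one.trans hM1
  -- constants: frame inversion for each length, frame-word estimate, Poincaré
  have hfr := fun n => exists_norm_cylWord_constFields_le_frameSum (F := ℝ) hM1 n
  choose Cf hCf0 hCf using hfr
  obtain ⟨C₄, hC₄0, hC₄⟩ := exists_cellL2_pje_le_neumann hL N
  obtain ⟨CP, hCP0, hCP⟩ := exists_cellL2_sub_average_le hL
  -- the number of frame words of length `≤ 4`
  set Nw : ℝ := ∑ m ∈ Finset.range (N + 3), (Fintype.card (Fin m → Option Bool) : ℝ) with hNw
  have hNw0 : 0 ≤ Nw := Finset.sum_nonneg fun m _ => Nat.cast_nonneg _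
  set Cmax : ℝ := ∑ n ∈ Finset.range (N + 3), Cf n with hCmax
  have hCmax0 : 0 ≤ Cmax := Finset.sum_nonneg fun n _ => hCf0 n
  have hCf_le : ∀ n, n ≤ N + 2 → Cf n ≤ Cmax := fun n hn =>
    Finset.single_le_sum (f := Cf) (fun n _ => hCf0 n) (Finset.mem_range.2 (by omega))
  refine ⟨Cmax * M ^ (N + 2) * (CP + Nw * C₄), by positivity, ?_⟩
  intro q G hq hG hqp hGp hN vs h1 h4 hl
  set n := vs.length with hn
  set 𝒟 : ℝ := cellL2 L (cylGrad q) + frameSize L N (cylLap q) + tanSize L N G + frameSize L N G with h𝒟def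
  have hD0 : 0 ≤ 𝒟 := by
    have := cellL2_nonneg L (cylGrad q); have := frameSize_nonneg (L := L) N (cylLap q)
    have := tanSize_nonneg (L := L) N G; have := frameSize_nonneg (L := L) N G
    positivity
  have hg0 : 0 ≤ cellL2 L (cylGrad q) := cellL2_nonneg L _
  -- `q̃ = q − ⨍ q`
  set qt : ℝ³ → ℝ := fun y => q y - ⨍ y in (cylinderCell L : Set ℝ³), q y with hqt
  have hqt_s : ContDiffOn ℝ ∞ qt 𝕂 := hq.sub contDiffOn_const
  -- the word of `q` is the word of `q̃`
  have hlen : 0 < vs.length := by rw [← hn]; exact h1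
  have hne : vs ≠ [] := List.ne_nil_of_length_pos hlen
  have hword : cylWord (constFields vs) q = cylWord (constFields vs) qt := by
    rw [hqt, cylWord_constFields_sub_const vs hne]
  -- the pointwise bound on the annulus
  set g : ℝ³ → ℝ := fun x => Cf n * M ^ n * ∑ m ∈ Finset.range (n + 1), ∑ om : Fin m → Option Bool,
    ‖cylWord (frameWord om) qt x‖ with hgdef
  have hfw_s : ∀ (m : ℕ) (om : Fin m → Option Bool), ContDiffOn ℝ ∞ (cylWord (frameWord om) qt) 𝕂 := fun m om =>
    contDiffOn_cylWord_frameWord om hqt_s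
  have hgc : ContinuousOn g 𝕂 :=
    continuousOn_const.mul (continuousOn_finsetSum _ fun m _ => continuousOn_finsetSum _ fun om _ => (hfw_s m om).continuousOn.norm)
  have hpt : ∀ x ∈ (cylinderCell L : Set ℝ³), (1 : ℝ) / 2 ≤ cylRadius x → ‖cylWord (constFields vs) q x‖ ≤ g x := by
    intro x hx hr
    rw [hword]
    exact hCf n vs hn.symm hl qt hqt_s (subset_closure (cylinderCell_le_unitCylinder L hx)) hr
  refine (annulusL2_le_cellL2_of_le L _ hgc hpt).trans ?_
  -- `cellL2 g` by the frame words of `q̃`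
  have hsum : cellL2 L g ≤ Cf n * M ^ n * ∑ m ∈ Finset.range (n + 1), ∑ om : Fin m → Option Bool,
      cellL2 L (cylWord (frameWord om) qt) := by
    have hc0 : 0 ≤ Cf n * M ^ n := mul_nonneg (hCf0 n) (pow_nonneg hM0 n)
    rw [hgdef, cellL2_const_mul L hc0]
    refine mul_le_mul_of_nonneg_left ?_ hc0
    refine (cellL2_sum_le L _ fun m _ => continuousOn_finsetSum _ fun om _ => (hfw_s m om).continuousOn.norm).trans
      (Finset.sum_le_sum fun m _ => ?_)
    refine (cellL2_sum_le L _ fun om _ => (hfw_s m om).continuousOn.norm).trans (le_of_eq ?_)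
    exact Finset.sum_congr rfl fun om _ => cellL2_norm L _
  refine hsum.trans ?_
  -- the zeroth-order term by Poincaré, the others by the frame-word estimate
  have hzero : ∑ om : Fin 0 → Option Bool, cellL2 L (cylWord (frameWord om) qt) ≤ CP * cellL2 L (cylGrad q) := by
    rw [sum_fin_zero_fun, frameWord_zero, cylWord_nil]
    exact hCP q hq
  have hpos : ∀ m ∈ Finset.range n, ∑ om : Fin (m + 1) → Option Bool, cellL2 L (cylWord (frameWord om) qt) ≤
      (Fintype.card (Fin (m + 1) → Option Bool) : ℝ) * (C₄ * 𝒟) := by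
    intro m hm
    have hm' : m + 1 ≤ N + 2 := by have := Finset.mem_range.1 hm; omega
    calc ∑ om : Fin (m + 1) → Option Bool, cellL2 L (cylWord (frameWord om) qt)
        ≤ ∑ _om : Fin (m + 1) → Option Bool, C₄ * 𝒟 := by
          refine Finset.sum_le_sum fun om _ => ?_
          obtain ⟨a, j, e, hsum', hEq⟩ := frameWord_normalForm (F := ℝ) (m + 1) om
          rw [cylWord_frameWord_succ_sub_const om q, cellL2_congr_K (hEq hq)]
          exact hC₄ q G hq hG hqp hGp hN a j e (by omega) (by omega)
      _ = (Fintype.card (Fin (m + 1) → Option Bool) : ℝ) * (C₄ * 𝒟) := by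
          rw [Finset.sum_const, Finset.card_univ, nsmul_eq_mul]
  have hcards : ∑ m ∈ Finset.range n, (Fintype.card (Fin (m + 1) → Option Bool) : ℝ) ≤ Nw := by
    have h1' : ∑ m ∈ Finset.range n, (Fintype.card (Fin (m + 1) → Option Bool) : ℝ) ≤
        ∑ m ∈ Finset.range (n + 1), (Fintype.card (Fin m → Option Bool) : ℝ) := by
      rw [Finset.sum_range_succ' (fun m => (Fintype.card (Fin m → Option Bool) : ℝ))]
      exact le_add_of_nonneg_right (Nat.cast_nonneg _)
    refine h1'.trans ?_
    rw [hNw]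
    exact Finset.sum_le_sum_of_subset_of_nonneg (Finset.range_mono (by omega)) fun m _ _ => Nat.cast_nonneg _
  have hsplit : ∑ m ∈ Finset.range (n + 1), ∑ om : Fin m → Option Bool, cellL2 L (cylWord (frameWord om) qt) ≤
      CP * cellL2 L (cylGrad q) + Nw * (C₄ * 𝒟) := by
    rw [Finset.sum_range_succ' (fun m => ∑ om : Fin m → Option Bool, cellL2 L (cylWord (frameWord om) qt))]
    rw [add_comm]
    refine add_le_add hzero ?_
    calc ∑ m ∈ Finset.range n, ∑ om : Fin (m + 1) → Option Bool, cellL2 L (cylWord (frameWord om) qt)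
        ≤ ∑ m ∈ Finset.range n, (Fintype.card (Fin (m + 1) → Option Bool) : ℝ) * (C₄ * 𝒟) :=
          Finset.sum_le_sum hpos
      _ = (∑ m ∈ Finset.range n, (Fintype.card (Fin (m + 1) → Option Bool) : ℝ)) * (C₄ * 𝒟) := by
          rw [Finset.sum_mul]
      _ ≤ Nw * (C₄ * 𝒟) := mul_le_mul_of_nonneg_right hcards (by positivity)
  have hMn : M ^ n ≤ M ^ (N + 2) := pow_le_pow_right₀ hM1 h4
  have hCfn : Cf n ≤ Cmax := hCf_le n h4
  calc Cf n * M ^ n * ∑ m ∈ Finset.range (n + 1), ∑ om : Fin m → Option Bool, cellL2 L (cylWord (frameWord om) qt)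
      ≤ Cf n * M ^ n * (CP * cellL2 L (cylGrad q) + Nw * (C₄ * 𝒟)) :=
        mul_le_mul_of_nonneg_left hsplit (mul_nonneg (hCf0 n) (pow_nonneg hM0 n))
    _ ≤ Cmax * M ^ (N + 2) * (CP * cellL2 L (cylGrad q) + Nw * (C₄ * 𝒟)) := by
        refine mul_le_mul_of_nonneg_right (mul_le_mul hCfn hMn (by positivity) hCmax0) (by positivity)
    _ ≤ Cmax * M ^ (N + 2) * (CP + Nw * C₄) * (𝒟 + cellL2 L (cylGrad q)) := by
        have h2 : CP * cellL2 L (cylGrad q) + Nw * (C₄ * 𝒟) ≤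
            (CP + Nw * C₄) * (𝒟 + cellL2 L (cylGrad q)) := by
          nlinarith [mul_nonneg hCP0 hD0, mul_nonneg (mul_nonneg hNw0 hC₄0) hg0]
        calc _ ≤ Cmax * M ^ (N + 2) * ((CP + Nw * C₄) * (𝒟 + cellL2 L (cylGrad q))) :=
              mul_le_mul_of_nonneg_left h2 (by positivity)
          _ = _ := by ring

end Literature.Analysis.FluidPDE
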